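import Mathlib.MeasureTheory.Integral.DominatedConvergence
import Mathlib.Analysis.SpecialFunctions.Pow.Integral
import Mathlib.Analysis.InnerProductSpace.Continuous
import Mathlib.Analysis.Normed.Group.Bounded
import Mathlib.MeasureTheory.Measure.Typeclasses.NullSingletonClass
import Literature.Analysis.FluidPDE.PineauVicolRSS
import Literature.Analysis.FluidPDE.PineauVicolRSSChaeWolf
import Literature.Analysis.FluidPDE.AxisymmetricVorticityTransport
import HarnessLib

/-!
# Route TypeICertificateLadder — crux `Target` (item stmt-NavierStokesRegularity-1217),
# line `killing-twisted-bernoulli-solitons`: weak vanishing of the slices of a rotated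
# self-similar field with subcritical tail (sub-goal TR1, stub
# `solitonBridge_tendsto_integral_of_tail`)

Helper file (theorems only). Let `v := pvAnsatz α (fun y _ => U y)` be Pineau–Vicol's rotated
self-similar ansatz field (arXiv:2607.09619, (1.7)):
`v(t, x) = (−t)^{−1/2} R(αs) U(R(−αs) x/√(−t))`, `s = −log(−t)`, for `t < 0`, with a continuous
profile `U` obeying the profile bound `‖U(y)‖ ≤ C₀/(‖y‖ + 1)` ((1.9), Remark 1.2) and the
*subcritical tail* condition `‖y‖ ‖U(y)‖ → 0` as `‖y‖ → ∞`. Then the slices `v(t, ·)` tend to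
zero weakly as `t ↑ 0`: for every continuous compactly supported `φ`,
`∫ ⟪v(t, x), φ(x)⟫ dx → 0` as `t → 0⁻`.

Proof: dominated convergence along the (countably generated) filter `𝓝[<] 0`. For `t < 0` and
`x ≠ 0` the profile bound gives `‖v(t, x)‖ ≤ C₀/(‖x‖ + √(−t)) ≤ C₀/‖x‖`
(`norm_pvAnsatz_le_of_profile`), so `|⟪v(t,x), φ(x)⟫| ≤ C₀ ‖x‖⁻¹ ‖φ(x)‖`, an integrable majorant
(`‖x‖⁻¹` is integrable on balls of `ℝ³`, Mathlib `integrableOn_ball_of_norm_le_rpow`, `1 < 3`);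
and pointwise, with `y(t) = R(−αs) x/√(−t)`, `‖y(t)‖ = ‖x‖/√(−t) → ∞`, so
`‖v(t, x)‖ = ‖y(t)‖ ‖U(y(t))‖ / ‖x‖ → 0` by the tail condition. This is the input "the slices
tend to `0` weakly at the blow-up time" of the backward-uniqueness rigidity
(`IsClassicalNSSolutionOn.curl_eq_zero_of_farField_of_tendsto`) used by the lead's assembly on
this line.

## References

* B. Pineau, V. Vicol, arXiv:2607.09619 (2026): (1.7), (1.9), (1.10), Remark 1.2.
  [PineauVicol2026]
-/

noncomputable section

-- the summit and its single sub-problem share the name (CONVENTIONS §1), as in every Theorems file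
set_option linter.dupNamespace false

namespace Summit.NavierStokesRegularity.NavierStokesRegularity.Theorems

open Set Function Filter MeasureTheory Metric
open scoped Topology RealInnerProductSpace
open Literature.Analysis Literature.Analysis.FluidPDE

/-- Each time slice of the rotated self-similar ansatz field with a continuous profile is
continuous in `x` (rotations are continuous linear maps). [cite: PineauVicol2026, (1.7) and Remark 1.2 (arXiv:2607.09619 pp. 3–4)] -/
private theorem solitonBridge_tail_continuous_slice (α : ℝ)
    {U : EuclideanSpace ℝ (Fin 3) → EuclideanSpace ℝ (Fin 3)} (hUc : Continuous U) (t : ℝ) :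
    Continuous fun x : EuclideanSpace ℝ (Fin 3) => pvAnsatz α (fun y _ => U y) t x := by
  have hrot : ∀ θ : ℝ, Continuous (rotZ θ) := fun θ => (rotZL θ).continuous
  unfold pvAnsatz
  exact (continuous_const (y := (Real.sqrt (-t))⁻¹)).smul
    ((hrot _).comp (hUc.comp ((hrot _).comp
      ((continuous_const (y := (Real.sqrt (-t))⁻¹)).smul continuous_id))))

/-- The constant of the profile bound `‖U(y)‖ ≤ C₀/(‖y‖ + 1)` is nonnegative (evaluate at
`y = 0`). [folklore] -/
private theorem solitonBridge_tail_const_nonneg {C₀ : ℝ}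
    {U : EuclideanSpace ℝ (Fin 3) → EuclideanSpace ℝ (Fin 3)}
    (hU : ∀ y : EuclideanSpace ℝ (Fin 3), ‖U y‖ ≤ C₀ / (‖y‖ + 1)) : 0 ≤ C₀ := by
  have h := hU 0
  rw [norm_zero, zero_add, div_one] at h
  exact (norm_nonneg _).trans h

/-- Off the origin the Type I bound of the ansatz field is dominated by the time-independent
majorant `C₀ ‖x‖⁻¹`: `‖v(t, x)‖ ≤ C₀/(‖x‖ + √(−t)) ≤ C₀/‖x‖` for `t < 0`, `x ≠ 0`. [cite: PineauVicol2026, (1.10) and Remark 1.2 (arXiv:2607.09619 pp. 3–4)] -/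
private theorem solitonBridge_tail_norm_slice_le {α C₀ : ℝ}
    {U : EuclideanSpace ℝ (Fin 3) → EuclideanSpace ℝ (Fin 3)}
    (hU : ∀ y : EuclideanSpace ℝ (Fin 3), ‖U y‖ ≤ C₀ / (‖y‖ + 1)) {t : ℝ} (ht : t < 0)
    {x : EuclideanSpace ℝ (Fin 3)} (hx : x ≠ 0) :
    ‖pvAnsatz α (fun y _ => U y) t x‖ ≤ C₀ * ‖x‖⁻¹ := by
  have hC := solitonBridge_tail_const_nonneg hU
  have hxpos : 0 < ‖x‖ := norm_pos_iff.2 hx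
  calc ‖pvAnsatz α (fun y _ => U y) t x‖ ≤ C₀ / (‖x‖ + Real.sqrt (-t)) :=
        norm_pvAnsatz_le_of_profile hU ht x
    _ ≤ C₀ / ‖x‖ :=
        div_le_div_of_nonneg_left hC hxpos (le_add_of_nonneg_right (Real.sqrt_nonneg _))
    _ = C₀ * ‖x‖⁻¹ := div_eq_mul_inv _ _

/-- The majorant `x ↦ C₀ ‖x‖⁻¹ ‖φ(x)‖` is integrable on `ℝ³` for `φ` continuous with compact
support: it is supported in a ball, bounded there by `(C₀ sup‖φ‖) ‖x‖⁻¹`, and `‖x‖⁻¹` is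
integrable on balls of `ℝ³` (`1 < 3 = dim`). [folklore] -/
private theorem solitonBridge_tail_integrable_bound {C₀ : ℝ} (hC : 0 ≤ C₀)
    {φ : EuclideanSpace ℝ (Fin 3) → EuclideanSpace ℝ (Fin 3)} (hφc : Continuous φ)
    (hφs : HasCompactSupport φ) :
    Integrable (fun x : EuclideanSpace ℝ (Fin 3) => C₀ * ‖x‖⁻¹ * ‖φ x‖) := by
  obtain ⟨M, hM⟩ := hφc.bounded_above_of_compact_support hφs
  obtain ⟨ρ, hρ⟩ := hφs.isCompact.isBounded.subset_ball (0 : EuclideanSpace ℝ (Fin 3))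
  have hsupp : support (fun x : EuclideanSpace ℝ (Fin 3) => C₀ * ‖x‖⁻¹ * ‖φ x‖) ⊆ ball 0 ρ := by
    intro x hx
    refine hρ (subset_tsupport _ ?_)
    rw [mem_support] at hx ⊢
    intro h0
    apply hx
    rw [h0, norm_zero, mul_zero]
  rw [← integrableOn_iff_integrable_of_support_subset hsupp]
  refine integrableOn_ball_of_norm_le_rpow (by rw [finrank_euclideanSpace_fin]; norm_num)
    (C := C₀ * M) (α := 1) (by rw [finrank_euclideanSpace_fin]; norm_num)
    (Eventually.of_forall fun x => ?_) ?_
  · rw [Real.rpow_neg_one, Real.norm_of_nonneg (by positivity)]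
    calc C₀ * ‖x‖⁻¹ * ‖φ x‖ ≤ C₀ * ‖x‖⁻¹ * M :=
          mul_le_mul_of_nonneg_left (hM x) (by positivity)
      _ = C₀ * M * ‖x‖⁻¹ := by ring
  · exact ((measurable_const.mul measurable_norm.inv).mul
      hφc.norm.measurable).aestronglyMeasurable

/-- `√(−t) → 0⁺` as `t → 0⁻`. [folklore] -/
private theorem solitonBridge_tail_tendsto_sqrt_neg :
    Tendsto (fun t : ℝ => Real.sqrt (-t)) (𝓝[<] (0 : ℝ)) (𝓝[>] 0) := by
  refine tendsto_nhdsWithin_iff.2 ⟨?_, ?_⟩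
  · have h : Tendsto (fun t : ℝ => Real.sqrt (-t)) (𝓝 0) (𝓝 (Real.sqrt (-0))) :=
      (Real.continuous_sqrt.comp continuous_neg).tendsto 0
    rw [neg_zero, Real.sqrt_zero] at h
    exact tendsto_nhdsWithin_of_tendsto_nhds h
  · filter_upwards [self_mem_nhdsWithin] with t ht
    exact Real.sqrt_pos.2 (neg_pos.2 ht)

/-- **Pointwise limit.** Off the origin the ansatz field tends to zero as `t → 0⁻` when the
profile has subcritical tail: with `y(t) = R(−αs) x/√(−t)`, `‖y(t)‖ = ‖x‖/√(−t) → ∞` and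
`‖v(t, x)‖ = ‖y(t)‖ ‖U(y(t))‖ / ‖x‖ → 0`. [cite: PineauVicol2026, (1.7) and Remark 1.2 (arXiv:2607.09619 pp. 3–4)] -/
private theorem solitonBridge_tail_tendsto_slice (α : ℝ)
    {U : EuclideanSpace ℝ (Fin 3) → EuclideanSpace ℝ (Fin 3)}
    (htail : Tendsto (fun y : EuclideanSpace ℝ (Fin 3) => ‖y‖ * ‖U y‖)
      (cocompact (EuclideanSpace ℝ (Fin 3))) (𝓝 0))
    {x : EuclideanSpace ℝ (Fin 3)} (hx : x ≠ 0) :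
    Tendsto (fun t : ℝ => pvAnsatz α (fun y _ => U y) t x) (𝓝[<] (0 : ℝ)) (𝓝 0) := by
  have hxpos : 0 < ‖x‖ := norm_pos_iff.2 hx
  set y : ℝ → EuclideanSpace ℝ (Fin 3) :=
    fun t => rotZ (-(α * -Real.log (-t))) ((Real.sqrt (-t))⁻¹ • x) with hy_def
  have hy_norm : ∀ t, ‖y t‖ = (Real.sqrt (-t))⁻¹ * ‖x‖ := fun t => by
    simp only [hy_def]
    rw [norm_rotZ, norm_smul, norm_inv, Real.norm_of_nonneg (Real.sqrt_nonneg _)]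
  have hinv : Tendsto (fun t : ℝ => (Real.sqrt (-t))⁻¹) (𝓝[<] (0 : ℝ)) atTop :=
    tendsto_inv_nhdsGT_zero.comp solitonBridge_tail_tendsto_sqrt_neg
  have hy : Tendsto y (𝓝[<] (0 : ℝ)) (cocompact (EuclideanSpace ℝ (Fin 3))) := by
    rw [← Metric.cobounded_eq_cocompact, ← tendsto_norm_atTop_iff_cobounded]
    simp only [hy_norm]
    exact hinv.atTop_mul_const hxpos
  have h2 : Tendsto (fun t => ‖y t‖ * ‖U (y t)‖) (𝓝[<] (0 : ℝ)) (𝓝 0) := htail.comp hy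
  have h3 : ∀ t, ‖pvAnsatz α (fun y _ => U y) t x‖ = ‖y t‖ * ‖U (y t)‖ / ‖x‖ := fun t => by
    rw [hy_norm]
    simp only [hy_def, pvAnsatz]
    rw [norm_smul, norm_rotZ, norm_inv, Real.norm_of_nonneg (Real.sqrt_nonneg _)]
    field_simp
  rw [tendsto_zero_iff_norm_tendsto_zero]
  simp only [h3]
  simpa using h2.div_const ‖x‖

/-- **Weak vanishing of the slices of a rotated self-similar field with subcritical tail
(sub-goal TR1 of the line `killing-twisted-bernoulli-solitons`).** Let `U : ℝ³ → ℝ³` be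
continuous with the profile bound `‖U(y)‖ ≤ C₀/(‖y‖ + 1)` (Pineau–Vicol (1.9)) and subcritical
tail `‖y‖ ‖U(y)‖ → 0` at infinity. Then for every continuous compactly supported `φ`, the
pairing of the slices of the rotated self-similar ansatz field `v = pvAnsatz α U` (1.7) with `φ`
tends to zero as `t ↑ 0`: `∫ ⟪v(t, x), φ(x)⟫ dx → 0` along `𝓝[<] 0`. Proof by dominated
convergence: majorant `C₀ ‖x‖⁻¹ ‖φ(x)‖` (from the Type I bound `‖v(t,x)‖ ≤ C₀/(‖x‖ + √(−t))`,
Remark 1.2), pointwise limit `0` off the origin from the tail condition, since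
`‖v(t, x)‖ = ‖y‖ ‖U(y)‖/‖x‖` with `‖y‖ = ‖x‖/√(−t) → ∞`. [cite: PineauVicol2026, (1.7) and Remark 1.2 (arXiv:2607.09619 pp. 3–4)] -/
theorem solitonBridge_tendsto_integral_of_tail : ∀ (C₀ α : ℝ) (U : EuclideanSpace ℝ (Fin 3) → EuclideanSpace ℝ (Fin 3)), Continuous U → (∀ y : EuclideanSpace ℝ (Fin 3), ‖U y‖ ≤ C₀ / (‖y‖ + 1)) → Filter.Tendsto (fun y : EuclideanSpace ℝ (Fin 3) => ‖y‖ * ‖U y‖) (Filter.cocompact (EuclideanSpace ℝ (Fin 3))) (nhds 0) → ∀ φ : EuclideanSpace ℝ (Fin 3) → EuclideanSpace ℝ (Fin 3), Continuous φ → HasCompactSupport φ → Filter.Tendsto (fun t : ℝ => ∫ x, inner ℝ (Literature.Analysis.FluidPDE.pvAnsatz α (fun y _ => U y) t x) (φ x)) (nhdsWithin 0 (Set.Iio 0)) (nhds 0) := by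
  intro C₀ α U hUc hU htail φ hφc hφs
  have hC : 0 ≤ C₀ := solitonBridge_tail_const_nonneg hU
  have hae : ∀ᵐ x ∂(volume : Measure (EuclideanSpace ℝ (Fin 3))), x ≠ 0 :=
    Measure.ae_ne volume 0
  have hlt : ∀ᶠ t in 𝓝[<] (0 : ℝ), t < 0 := self_mem_nhdsWithin
  have key : Tendsto (fun t : ℝ => ∫ x, ⟪pvAnsatz α (fun y _ => U y) t x, φ x⟫)
      (𝓝[<] (0 : ℝ)) (𝓝 (∫ _ : EuclideanSpace ℝ (Fin 3), (0 : ℝ))) := by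
    refine tendsto_integral_filter_of_dominated_convergence
      (fun x : EuclideanSpace ℝ (Fin 3) => C₀ * ‖x‖⁻¹ * ‖φ x‖) ?_ ?_
      (solitonBridge_tail_integrable_bound hC hφc hφs) ?_
    · exact Eventually.of_forall fun t =>
        ((solitonBridge_tail_continuous_slice α hUc t).inner hφc).aestronglyMeasurable
    · filter_upwards [hlt] with t ht
      filter_upwards [hae] with x hx
      calc ‖⟪pvAnsatz α (fun y _ => U y) t x, φ x⟫‖
          ≤ ‖pvAnsatz α (fun y _ => U y) t x‖ * ‖φ x‖ := norm_inner_le_norm _ _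
        _ ≤ C₀ * ‖x‖⁻¹ * ‖φ x‖ :=
          mul_le_mul_of_nonneg_right (solitonBridge_tail_norm_slice_le hU ht hx) (norm_nonneg _)
    · filter_upwards [hae] with x hx
      have h := Filter.Tendsto.inner (𝕜 := ℝ) (solitonBridge_tail_tendsto_slice α htail hx)
        (tendsto_const_nhds (x := φ x))
      simpa using h
  simpa using key

end Summit.NavierStokesRegularity.NavierStokesRegularity.Theorems
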